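import Literature.NumberTheory.Sieve.MoebiusShiftedPrimesArcs
import Literature.NumberTheory.Sieve.MoebiusShiftedPrimesSieveBound
import Mathlib.NumberTheory.Harmonic.Bounds
import HarnessLib

/-!
# Möbius on shifted primes — Theorem 2.2 from the minor arc bound (3.1) of Lichtman 2020

Topic `Literature/NumberTheory/Sieve`, fifth layer of the decomposition of the named fact
`Literature.NumberTheory.Sieve.lichtman2020_moebius_shifted_primes_avg` (J. D. Lichtman, *Averages of the Möbius function on
shifted primes*, Q. J. Math. (2021), doi:10.1093/qmath/haab054, arXiv:2009.08969 [Lichtman2020],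
Theorem 1.1, qualitative part), after `MoebiusShiftedPrimesProofs`, `…SieveBound`, `…Liouville`,
`…Arcs`.  Page numbers refer to the held copy `paper:arxiv-2009.08969`.

## Why this file

`MoebiusShiftedPrimesArcs.lean` reduces Theorem 1.1 to Proposition 3.1 (minor arcs) and
Proposition 3.2 (major arcs) as printed.  Reading §3.1 (pp. 9–10) shows that what is actually
established for the minor arcs is display (3.1),
`I_𝔪 ≪ HX (log log X/(dW))^{1/2} ψ(X)`, and that the printed step "it suffices to show (3.1)" towards
the bound `HX/(d^{3/4} W^{1/5})` of Proposition 3.1 requires `ψ(X) (log log X)^{1/2} d^{1/4} ≪ W^{3/10}`,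
which fails when `ψ(X)` is as large as the standing regime `H ≤ exp((log X)^{2/3})` allows (it holds
when `ψ(X) ≪ (log X)^{A/20 - ε}`).  Theorem 2.2 — hence Theorem 1.1 — does not need the `d^{-3/4}`
decay: with the (3.1)-form the `d`-sum in the deduction of Theorem 2.2 is `∑_{d ≤ √W} 1/d ≤ 1 + log √W`
and the saving is still `≫ W^{1/5}` because `3A/10 > 5/6` for `A > 5`.  This file records (3.1) as a
named fact and proves Theorem 2.2 from it and Proposition 3.2, so that a future bottom-up proof of
§3.1 lands on printed ground.

## Content

* `Lichtman2020_minorArcBound31` — NAMED FACT: display (3.1), p. 9 (conventions of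
  `Lichtman2020_minorArcEstimate`).
* `Lichtman2020.keyFourier_fixed_bound_general` — PROVED: Theorem 2.2 at a fixed `X` from an arbitrary
  per-modulus bound `B(e)` (variant of `keyFourier_fixed_bound`).
* `Lichtman2020_keyFourierEstimate_of_weakLiouvilleBound` — PROVED: a key Fourier estimate for `λ`
  of the weak shape `C HX (log X)^κ/√(dW)` (`κ < 3/2`, all `α`, all `1 ≤ d ≤ W`; an explicit
  hypothesis, not a new named fact) implies Thm 2.2 (`Lichtman2020_keyFourierEstimate`):
  `B(e) = (log X)^κ/√(eW)`, `∑_{d ≤ √W} 1/d ≤ 1 + log √W`, and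
  `C₀ (log X)^κ (1 + ½A log log X) W^{1/5} ≤ √W` eventually as `κ < 3/2 < 3A/10`
  (`eventually_minor_saving`).  Any proved versions of the two arcs can be plugged in through it.
* `Lichtman2020.weakLiouvilleBound_of_minorArcBound31` — PROVED: display (3.1) + Prop 3.2 give the
  weak shape with `κ = 2/3` (periodicity reduces `α` to `[0,1] = 𝔐 ∪ 𝔪`; `HX/(dW) ≤ HX(log X)^{2/3}/√(dW)`
  on `𝔐`; `√(log log X) ψ(X) ≤ log H ≤ (log X)^{2/3}` on `𝔪`); a version of (3.1) carrying the
  logarithm `1 + log(qP)` of Vinogradov's lemma in the form of the tree's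
  `Literature.NumberTheory.Sieve.Vinogradov.sum_geomBound_div_le` would give `κ = 4/3`.
* `Lichtman2020_keyFourierEstimate_of_minorArcBound31` — PROVED: (3.1) + Prop 3.2 ⟹ Thm 2.2.
* `lichtman2020_moebius_shifted_primes_avg_of_minorArcBound31 : (3.1) → Prop 3.2 → Thm 1.1` and
  `lichtman2020_moebius_shifted_primes_avg_of_arcs' : Prop 3.1 → Prop 3.2 → Thm 1.1` (the sieve bound
  (2.5) being the proved `Lichtman2020_shiftedPrimeSieveBound_holds`) — PROVED.

## Source

* J. D. Lichtman, *Averages of the Möbius function on shifted primes*, arXiv:2009.08969, §3.1 pp. 9–10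
  (display (3.1) and its proof), §3 p. 9 (Props 3.1, 3.2), §2 pp. 7–8 (Thm 2.2, Prop 2.3).
-/

open Filter Asymptotics Finset MeasureTheory
open scoped FourierTransform Topology

namespace Literature.NumberTheory.Sieve

/-! ### Display (3.1): the minor arc bound as established in §3.1 -/

/-- NAMED FACT — **Lichtman 2020, display (3.1) (the minor arc bound in the form proved in §3.1)**,
as printed (p. 9, proof of Proposition 3.1): "It suffices to show
`I_𝔪 := ∫_ℝ θ(x) ∑_{x ≤ nd ≤ x+H} 𝟙_{S_d}(n) g(n) e(nα) dx ≪ HX (log log X/(dW))^{1/2} ψ(X)`,   (3.1)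
uniformly for any `α ∈ 𝔪` and measurable `θ : [0,X] → ℂ` with `|θ(x)| ≤ 1`", in the setting of
Proposition 3.1 (`A > 5`, `H = (log X)^{ψ(X)}`, `ψ → ∞`, `d ≤ W = (log X)^A`, `g` completely
multiplicative with `|g| ≤ 1`; pp. 9–10 then prove (3.1)).  The supremum over such `θ` of `|I_𝔪|` is
`∫₀^X |∑_{x ≤ nd ≤ x+H, n ∈ S_d} g(n) e(nα)| dx`, which is how the bound is recorded.  Conventions and
the two documented deviations (regime `H ≤ exp((log X)^{2/3})`, set `S_d(X,A,δ)` for any `δ ≥ 0`)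
are those of `Lichtman2020_minorArcEstimate` (`MoebiusShiftedPrimesArcs.lean`); `ψ(X)` is
`log H(X)/log log X`; the constant is chosen after `δ` and the function `H` (weaker than "`≪`").
WHY THIS FACT: the printed passage from (3.1) to the bound `HX/(d^{3/4}W^{1/5})` of Proposition 3.1
needs `ψ(X) (log log X)^{1/2} d^{1/4} ≪ W^{3/10}`, which fails for `ψ` as large as the regime allows;
(3.1) is what §3.1 establishes, and it suffices for Theorem 2.2
(`Lichtman2020_keyFourierEstimate_of_minorArcBound31`).  Users take
`(h : Lichtman2020_minorArcBound31)`. [cite: Lichtman2020, (3.1)] -/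
def Lichtman2020_minorArcBound31 : Prop :=
  ∀ A : ℝ, 5 < A → ∀ δ : ℝ, 0 ≤ δ → ∀ H : ℕ → ℕ,
    Tendsto (fun X : ℕ => Real.log (H X) / Real.log (Real.log X)) atTop atTop →
    (∀ᶠ X : ℕ in atTop, (H X : ℝ) ≤ Real.exp (Real.log X ^ (2 / 3 : ℝ))) →
    ∃ C : ℝ, ∀ᶠ X : ℕ in atTop, ∀ d : ℕ, 1 ≤ d → (d : ℝ) ≤ Real.log X ^ A →
      ∀ g : ℕ → ℂ, g 1 = 1 → (∀ m n : ℕ, g (m * n) = g m * g n) → (∀ n : ℕ, ‖g n‖ ≤ 1) →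
      ∀ α ∈ lichtmanMinorArcs (Real.log X ^ A) ((H X : ℝ) / Real.log X ^ (4 * A)),
        ∫ x in (0 : ℝ)..X,
            ‖twistedSum g ((Icc ⌈x / d⌉₊ ⌊(x + H X) / d⌋₊).filter (lichtmanTypical X A δ (H X))) α‖
          ≤ C * ((H X : ℝ) * X *
              (Real.sqrt (Real.log (Real.log X) / ((d : ℝ) * Real.log X ^ A)) *
                (Real.log (H X) / Real.log (Real.log X))))

namespace Lichtman2020

/-! ### Theorem 2.2 from a general per-modulus bound -/

/-- **Theorem 2.2 at a fixed `X` from a general per-modulus bound** (variant of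
`keyFourier_fixed_bound` with the Proposition-2.3 shape `e^{-3/4} W^{-1/5}` replaced by an arbitrary
`B(e)`): `∑_{k ≤ X} |∑_{n ∈ {k..k+H-1} ∩ S} μ(n)e(nα)| ≤ C HX ∑_{d ≤ M} B(d²) + 4HX/W^{1/5}`.
[cite: Lichtman2020, §2, (2.9)–(2.11)] -/
theorem keyFourier_fixed_bound_general {X H M D : ℕ} {W C : ℝ} (B : ℕ → ℝ) (S : ℕ → Prop)
    [DecidablePred S] (α : ℝ)
    (hH : 1 ≤ H) (hHX : H ≤ X) (hW4 : 4 ≤ W) (hM : M = ⌊Real.sqrt W⌋₊) (hD : X + H ≤ D)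
    (hP : ∀ e : ℕ, 1 ≤ e → (e : ℝ) ≤ W → ∀ β : ℝ,
      ∑ k ∈ Icc 1 X, ‖liouvilleTwistedSum ((windowDiv e H k).filter S) β‖ ≤ C * ((H : ℝ) * X) * B e)
    (hS : ∀ d : ℕ, 1 ≤ d → d ≤ M → ∀ m : ℕ, S (d ^ 2 * m) ↔ S m) :
    ∑ k ∈ Icc 1 X, ‖moebiusTwistedSum ((Icc k (k + H - 1)).filter S) α‖ ≤
      C * ((H : ℝ) * X) * ∑ d ∈ Icc 1 M, B (d ^ 2) + 4 * ((H : ℝ) * X / W ^ (1 / 5 : ℝ)) := by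
  have hW0 : 0 < W := by linarith
  have hW1 : 1 ≤ W := by linarith
  have hX0 : (0 : ℝ) ≤ X := Nat.cast_nonneg _
  have hH0 : (0 : ℝ) ≤ H := Nat.cast_nonneg _
  have hHX' : (H : ℝ) ≤ X := by exact_mod_cast hHX
  have hW5 : 0 < W ^ (1 / 5 : ℝ) := Real.rpow_pos_of_pos hW0 _
  have hsW2 : 2 ≤ Real.sqrt W := by
    rw [show (2 : ℝ) = Real.sqrt 4 by
      rw [show (4 : ℝ) = 2 ^ 2 by norm_num, Real.sqrt_sq (by norm_num : (0 : ℝ) ≤ 2)]]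
    exact Real.sqrt_le_sqrt hW4
  have hMle : (M : ℝ) ≤ Real.sqrt W := by rw [hM]; exact Nat.floor_le (Real.sqrt_nonneg _)
  have hMlt : Real.sqrt W < M + 1 := by rw [hM]; exact Nat.lt_floor_add_one _
  have hM2 : 2 ≤ M := by rw [hM]; exact Nat.le_floor (by exact_mod_cast hsW2)
  have hM1 : 1 ≤ M := by omega
  have hM0 : (0 : ℝ) < M := by exact_mod_cast (by omega : 0 < M)
  set T : ℕ → ℕ → ℂ := fun d k =>
    ∑ m ∈ (windowDiv (d ^ 2) H k).filter (fun m => S (d ^ 2 * m)),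
      ((ArithmeticFunction.liouville m : ℤ) : ℂ) * (𝐞 (((d ^ 2 * m : ℕ) : ℝ) * α) : ℂ) with hT
  have hstep1 : ∀ k ∈ Icc 1 X, ‖moebiusTwistedSum ((Icc k (k + H - 1)).filter S) α‖ ≤
      ∑ d ∈ Icc 1 D, ‖T d k‖ := by
    intro k hk
    rw [Finset.mem_Icc] at hk
    rw [moebiusTwistedSum_filter_Icc_eq k H D hk.1 (by omega) S α]
    refine (norm_sum_le _ _).trans (Finset.sum_le_sum fun d _ => ?_)
    rw [norm_mul]
    have hμ : ‖((ArithmeticFunction.moebius d : ℤ) : ℂ)‖ ≤ 1 := by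
      rw [Complex.norm_intCast]
      exact_mod_cast (ArithmeticFunction.abs_moebius_le_one (n := d))
    calc ‖((ArithmeticFunction.moebius d : ℤ) : ℂ)‖ * ‖T d k‖ ≤ 1 * ‖T d k‖ :=
          mul_le_mul_of_nonneg_right hμ (norm_nonneg _)
      _ = ‖T d k‖ := one_mul _
  have htriv : ∀ d k, ‖T d k‖ ≤ #(windowDiv (d ^ 2) H k) := by
    intro d k
    refine (norm_sum_le _ _).trans ?_
    calc ∑ m ∈ (windowDiv (d ^ 2) H k).filter (fun m => S (d ^ 2 * m)),
          ‖((ArithmeticFunction.liouville m : ℤ) : ℂ) * (𝐞 (((d ^ 2 * m : ℕ) : ℝ) * α) : ℂ)‖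
        ≤ ∑ m ∈ (windowDiv (d ^ 2) H k).filter (fun m => S (d ^ 2 * m)), (1 : ℝ) := by
          refine Finset.sum_le_sum fun m _ => ?_
          rw [norm_mul, Complex.norm_intCast, norm_fourierChar, mul_one]
          exact_mod_cast abs_liouville_le_one m
      _ = #((windowDiv (d ^ 2) H k).filter (fun m => S (d ^ 2 * m))) := by simp
      _ ≤ #(windowDiv (d ^ 2) H k) := by exact_mod_cast Finset.card_filter_le _ _
  have hsmall : ∀ d ∈ Icc 1 M, ∑ k ∈ Icc 1 X, ‖T d k‖ ≤ C * ((H : ℝ) * X) * B (d ^ 2) := by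
    intro d hd
    rw [Finset.mem_Icc] at hd
    have hTeq : ∀ k, T d k =
        liouvilleTwistedSum ((windowDiv (d ^ 2) H k).filter S) ((d : ℝ) ^ 2 * α) := by
      intro k
      rw [hT, liouvilleTwistedSum]
      simp only
      rw [Finset.filter_congr (fun m _ => hS d hd.1 hd.2 m)]
      refine Finset.sum_congr rfl fun m _ => ?_
      congr 2
      push_cast
      ring
    simp_rw [hTeq]
    have he1 : 1 ≤ d ^ 2 := Nat.one_le_pow _ _ hd.1
    have heW : ((d ^ 2 : ℕ) : ℝ) ≤ W := by
      have h1 : (d : ℝ) ≤ Real.sqrt W := le_trans (by exact_mod_cast hd.2) hMle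
      have h2 : (d : ℝ) ^ 2 ≤ Real.sqrt W ^ 2 := pow_le_pow_left₀ (Nat.cast_nonneg _) h1 2
      rw [Real.sq_sqrt hW0.le] at h2
      exact_mod_cast h2
    exact hP (d ^ 2) he1 heW ((d : ℝ) ^ 2 * α)
  have hlarge : ∀ d ∈ Ioc M D, ∑ k ∈ Icc 1 X, ‖T d k‖ ≤ 2 * ((H : ℝ) * X) * ((d : ℝ) ^ 2)⁻¹ := by
    intro d hd
    rw [Finset.mem_Ioc] at hd
    calc ∑ k ∈ Icc 1 X, ‖T d k‖ ≤ ∑ k ∈ Icc 1 X, (#(windowDiv (d ^ 2) H k) : ℝ) :=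
          Finset.sum_le_sum fun k _ => htriv d k
      _ ≤ (H : ℝ) * ((X : ℝ) + H) / ((d ^ 2 : ℕ) : ℝ) :=
          sum_card_windowDiv_le X H (d ^ 2) (Nat.one_le_pow _ _ (by omega)) hH
      _ ≤ (H : ℝ) * ((X : ℝ) + X) / ((d ^ 2 : ℕ) : ℝ) := by
          apply div_le_div_of_nonneg_right _ (by positivity)
          exact mul_le_mul_of_nonneg_left (by linarith) hH0
      _ = 2 * ((H : ℝ) * X) * ((d : ℝ) ^ 2)⁻¹ := by push_cast; ring
  have hsum_small : ∑ d ∈ Icc 1 M, ∑ k ∈ Icc 1 X, ‖T d k‖ ≤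
      C * ((H : ℝ) * X) * ∑ d ∈ Icc 1 M, B (d ^ 2) := by
    rw [Finset.mul_sum]
    exact Finset.sum_le_sum hsmall
  have hsum_large : ∑ d ∈ Ioc M D, ∑ k ∈ Icc 1 X, ‖T d k‖ ≤ 4 * ((H : ℝ) * X / W ^ (1 / 5 : ℝ)) := by
    rcases le_or_gt M D with hMD | hMD
    · calc ∑ d ∈ Ioc M D, ∑ k ∈ Icc 1 X, ‖T d k‖
          ≤ ∑ d ∈ Ioc M D, 2 * ((H : ℝ) * X) * ((d : ℝ) ^ 2)⁻¹ := Finset.sum_le_sum hlarge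
        _ = 2 * ((H : ℝ) * X) * ∑ d ∈ Ioc M D, ((d : ℝ) ^ 2)⁻¹ := by rw [Finset.mul_sum]
        _ ≤ 2 * ((H : ℝ) * X) * (M : ℝ)⁻¹ := by
            apply mul_le_mul_of_nonneg_left _ (by positivity)
            have h1 := sum_Ioc_inv_sq_le_sub (α := ℝ) (by omega : M ≠ 0) hMD
            have h2 : 0 ≤ (D : ℝ)⁻¹ := by positivity
            linarith
        _ ≤ 2 * ((H : ℝ) * X) * (2 / Real.sqrt W) := by
            apply mul_le_mul_of_nonneg_left _ (by positivity)
            rw [inv_eq_one_div, div_le_div_iff₀ hM0 (by linarith)]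
            linarith
        _ = 4 * ((H : ℝ) * X) / Real.sqrt W := by ring
        _ ≤ 4 * ((H : ℝ) * X) / W ^ (1 / 5 : ℝ) := by
            apply div_le_div_of_nonneg_left (by positivity) hW5
            rw [Real.sqrt_eq_rpow]
            exact Real.rpow_le_rpow_of_exponent_le hW1 (by norm_num)
        _ = 4 * ((H : ℝ) * X / W ^ (1 / 5 : ℝ)) := by ring
    · rw [Finset.Ioc_eq_empty (by omega), Finset.sum_empty]
      positivity
  calc ∑ k ∈ Icc 1 X, ‖moebiusTwistedSum ((Icc k (k + H - 1)).filter S) α‖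
      ≤ ∑ k ∈ Icc 1 X, ∑ d ∈ Icc 1 D, ‖T d k‖ := Finset.sum_le_sum hstep1
    _ = ∑ d ∈ Icc 1 D, ∑ k ∈ Icc 1 X, ‖T d k‖ := Finset.sum_comm
    _ = ∑ d ∈ (Icc 1 D).filter (fun d => d ≤ M), ∑ k ∈ Icc 1 X, ‖T d k‖ +
          ∑ d ∈ (Icc 1 D).filter (fun d => ¬ d ≤ M), ∑ k ∈ Icc 1 X, ‖T d k‖ :=
        (Finset.sum_filter_add_sum_filter_not _ _ _).symm
    _ ≤ ∑ d ∈ Icc 1 M, ∑ k ∈ Icc 1 X, ‖T d k‖ + ∑ d ∈ Ioc M D, ∑ k ∈ Icc 1 X, ‖T d k‖ := by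
        apply add_le_add
        · refine Finset.sum_le_sum_of_subset_of_nonneg ?_ fun d _ _ =>
            Finset.sum_nonneg fun k _ => norm_nonneg _
          intro d hd
          rw [Finset.mem_filter, Finset.mem_Icc] at hd
          rw [Finset.mem_Icc]
          exact ⟨hd.1.1, hd.2⟩
        · refine Finset.sum_le_sum_of_subset_of_nonneg ?_ fun d _ _ =>
            Finset.sum_nonneg fun k _ => norm_nonneg _
          intro d hd
          rw [Finset.mem_filter, Finset.mem_Icc] at hd
          rw [Finset.mem_Ioc]
          exact ⟨by omega, hd.1.2⟩
    _ ≤ _ := add_le_add hsum_small hsum_large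

/-- The harmonic bound `∑_{d=1}^{M} 1/d ≤ 1 + log M` (Mathlib's `harmonic_le_one_add_log`).
[folklore] -/
theorem sum_Icc_inv_le_one_add_log (M : ℕ) :
    ∑ d ∈ Icc 1 M, (d : ℝ)⁻¹ ≤ 1 + Real.log M := by
  have h := harmonic_le_one_add_log M
  simp_rw [harmonic_eq_sum_Icc, Rat.cast_sum, Rat.cast_inv, Rat.cast_natCast] at h
  exact h

/-- The discrete window sums are `1`-periodic in the frequency. [folklore] -/
theorem sum_norm_liouvilleTwistedSum_fract (X e H : ℕ) (S : ℕ → Prop) [DecidablePred S] (β : ℝ) :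
    ∑ k ∈ Icc 1 X, ‖liouvilleTwistedSum ((windowDiv e H k).filter S) (Int.fract β)‖ =
      ∑ k ∈ Icc 1 X, ‖liouvilleTwistedSum ((windowDiv e H k).filter S) β‖ := by
  simp_rw [liouvilleTwistedSum_fract]

/-- Eventually `C (log X)^κ (1 + (A/2) log log X) (log X)^{A/5} ≤ (log X)^{A/2}` for `κ < 3A/10`.
[folklore] -/
theorem eventually_minor_saving (A C κ : ℝ) (hκ : κ < 3 * A / 10) :
    ∀ᶠ X : ℕ in atTop, C * (Real.log X ^ κ * (1 + A / 2 * Real.log (Real.log X)) *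
      Real.log X ^ (A / 5)) ≤ Real.log X ^ (A / 2) := by
  set η : ℝ := (3 * A / 10 - κ) / 2 with hη
  have hη0 : 0 < η := by rw [hη]; linarith
  have h1 : ∀ᶠ X : ℕ in atTop, |C| * (1 + |A| / (2 * η)) ≤ Real.log X ^ η :=
    ((tendsto_rpow_atTop hη0).comp tendsto_log_natCast).eventually_ge_atTop _
  filter_upwards [h1, tendsto_log_natCast.eventually_ge_atTop 1] with X hX hL1
  set L := Real.log (X : ℝ) with hL
  have hL0 : 0 < L := by linarith
  have hlog : Real.log L ≤ L ^ η / η := Real.log_le_rpow_div hL0.le hη0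
  have hlog0 : 0 ≤ Real.log L := Real.log_nonneg hL1
  have hLη : 1 ≤ L ^ η := Real.one_le_rpow hL1 hη0.le
  have hfac : 1 + A / 2 * Real.log L ≤ (1 + |A| / (2 * η)) * L ^ η := by
    have h2 : A / 2 * Real.log L ≤ |A| / 2 * Real.log L :=
      mul_le_mul_of_nonneg_right (by linarith [le_abs_self A]) hlog0
    have h3 : |A| / 2 * Real.log L ≤ |A| / 2 * (L ^ η / η) :=
      mul_le_mul_of_nonneg_left hlog (by positivity)
    have h4 : |A| / 2 * (L ^ η / η) = |A| / (2 * η) * L ^ η := by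
      field_simp
    have h5 : (1 : ℝ) ≤ 1 * L ^ η := by linarith
    nlinarith [h2, h3, h4, h5, abs_nonneg A]
  have hfac0 : |1 + A / 2 * Real.log L| ≤ (1 + |A| / (2 * η)) * L ^ η := by
    rw [abs_le]
    refine ⟨?_, hfac⟩
    have : A / 2 * Real.log L ≥ -(|A| / 2 * Real.log L) := by
      have := neg_abs_le A
      nlinarith
    have h6 : 0 ≤ |A| / (2 * η) * L ^ η := by positivity
    have h7 : |A| / 2 * Real.log L ≤ |A| / (2 * η) * L ^ η := by
      have h3 : |A| / 2 * Real.log L ≤ |A| / 2 * (L ^ η / η) :=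
        mul_le_mul_of_nonneg_left hlog (by positivity)
      have h4 : |A| / 2 * (L ^ η / η) = |A| / (2 * η) * L ^ η := by field_simp
      linarith
    nlinarith
  have hκ' : 0 < L ^ κ := Real.rpow_pos_of_pos hL0 _
  have h5 : 0 < L ^ (A / 5) := Real.rpow_pos_of_pos hL0 _
  have hprod : L ^ κ * L ^ η * L ^ (A / 5) * L ^ η = L ^ (A / 2) := by
    rw [← Real.rpow_add hL0, ← Real.rpow_add hL0, ← Real.rpow_add hL0, hη]; ring_nf
  calc C * (L ^ κ * (1 + A / 2 * Real.log L) * L ^ (A / 5))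
      ≤ |C * (L ^ κ * (1 + A / 2 * Real.log L) * L ^ (A / 5))| := le_abs_self _
    _ = |C| * (L ^ κ * |1 + A / 2 * Real.log L| * L ^ (A / 5)) := by
        rw [abs_mul, abs_mul, abs_mul, abs_of_pos hκ', abs_of_pos h5]
    _ ≤ |C| * (L ^ κ * ((1 + |A| / (2 * η)) * L ^ η) * L ^ (A / 5)) := by
        apply mul_le_mul_of_nonneg_left _ (abs_nonneg C)
        apply mul_le_mul_of_nonneg_right _ h5.le
        exact mul_le_mul_of_nonneg_left hfac0 hκ'.le
    _ = (|C| * (1 + |A| / (2 * η))) * (L ^ κ * L ^ η * L ^ (A / 5)) := by ring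
    _ ≤ L ^ η * (L ^ κ * L ^ η * L ^ (A / 5)) := mul_le_mul_of_nonneg_right hX (by positivity)
    _ = L ^ (A / 2) := by rw [← hprod]; ring

end Lichtman2020

open Lichtman2020 in
/-- **Theorem 2.2 from a weak key Fourier estimate for `λ` of shape `(log X)^κ/√(dW)`,
`κ < 3/2`** — the robust form of the step "Thm 2.2 ⇐ circle method".  The hypothesis is an
abstraction (stated explicitly, not a claim of the source): for the sets `S_d` and windows of
Proposition 2.3, `∫₀^X |∑_{x ≤ nd ≤ x+H, n ∈ S_d} λ(n)e(nα)| dx ≤ C HX (log X)^κ/√(dW)` for all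
`1 ≤ d ≤ W`, all `α`, eventually in `X` (regime `H ≤ exp((log X)^{2/3})`).  Display (3.1) with
Proposition 3.2 gives it with `κ = 2/3` (`weakLiouvilleBound_of_minorArcBound31`); a version of
(3.1) carrying the logarithm of Vinogradov's lemma (`Literature.NumberTheory.Sieve.Vinogradov.sum_geomBound_div_le`) would
give `κ = 4/3`.  Proof: `μ(n) = ∑_{d² ∣ n} μ(d)λ(n/d²)`, the hypothesis at the moduli `e = d² ≤ W`
(`𝟙_S(d²m) = 𝟙_S(m)`), `∑_{d ≤ √W} 1/d ≤ 1 + log √W`, the tail `4HX/W^{1/5}` of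
`keyFourier_fixed_bound_general`, and `C (log X)^κ (1 + ½A log log X) W^{1/5} ≤ √W` eventually since
`κ < 3/2 < 3A/10` (`eventually_minor_saving`); total `≤ 5 HX/(log X)^{A/5}`.
[cite: Lichtman2020, Theorem 2.2 and §2–3] -/
theorem Lichtman2020_keyFourierEstimate_of_weakLiouvilleBound {κ : ℝ} (hκ : κ < 3 / 2)
    (hweak : ∀ A : ℝ, 5 < A → ∀ δ : ℝ, 0 < δ → ∀ H : ℕ → ℕ,
      Tendsto (fun X : ℕ => Real.log (H X) / Real.log (Real.log X)) atTop atTop →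
      (∀ᶠ X : ℕ in atTop, (H X : ℝ) ≤ Real.exp (Real.log X ^ (2 / 3 : ℝ))) →
      ∃ C : ℝ, ∀ᶠ X : ℕ in atTop, ∀ d : ℕ, 1 ≤ d → (d : ℝ) ≤ Real.log X ^ A → ∀ α : ℝ,
        ∫ x in (0 : ℝ)..X,
            ‖liouvilleTwistedSum
                ((Icc ⌈x / d⌉₊ ⌊(x + H X) / d⌋₊).filter (lichtmanTypical X A δ (H X))) α‖
          ≤ C * ((H X : ℝ) * X * (Real.log X ^ κ / Real.sqrt ((d : ℝ) * Real.log X ^ A)))) :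
    Lichtman2020_keyFourierEstimate := by
  intro A hA δ hδ H hH hHexp
  have hA0 : 0 < A := by linarith
  obtain ⟨C, hC⟩ := hweak A hA δ hδ H hH hHexp
  set C₀ : ℝ := max C 0 with hC₀
  have hC₀0 : 0 ≤ C₀ := le_max_right _ _
  have hCC : C ≤ C₀ := le_max_left _ _
  refine ⟨1 + 4, ?_⟩
  have hone := eventually_one_le_H hH
  have hW4 : ∀ᶠ X : ℕ in atTop, 4 ≤ Real.log X ^ A :=
    ((tendsto_rpow_atTop hA0).comp tendsto_log_natCast).eventually_ge_atTop 4
  have hκA : κ < 3 * A / 10 := by linarith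
  filter_upwards [hC, hHexp, hone, hW4, tendsto_log_natCast.eventually_gt_atTop 1,
    eventually_sqrtW_lt_P2 A δ hδ, eventually_gt_atTop 0, eventually_minor_saving A C₀ κ hκA]
    with X hCX hHX h1 hW4X hL1 hP2 hX0 hsav α
  have hX0' : (0 : ℝ) < X := by exact_mod_cast hX0
  have hL0 : 0 < Real.log X := by linarith
  set L : ℝ := Real.log X with hL
  set W : ℝ := L ^ A with hW
  have hW0 : 0 < W := Real.rpow_pos_of_pos hL0 _
  have hW1 : 1 ≤ W := by linarith
  have hW15 : W ^ (1 / 5 : ℝ) = L ^ (A / 5) := by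
    rw [hW, ← Real.rpow_mul hL0.le]; ring_nf
  have hW12 : Real.sqrt W = L ^ (A / 2) := by
    rw [Real.sqrt_eq_rpow, hW, ← Real.rpow_mul hL0.le]; ring_nf
  have hHleX : H X ≤ X := by
    have h2 : L ^ (2 / 3 : ℝ) ≤ L := by
      calc L ^ (2 / 3 : ℝ) ≤ L ^ (1 : ℝ) := Real.rpow_le_rpow_of_exponent_le hL1.le (by norm_num)
        _ = L := Real.rpow_one _
    have h3 : (H X : ℝ) ≤ X := by
      calc (H X : ℝ) ≤ Real.exp (L ^ (2 / 3 : ℝ)) := hHX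
        _ ≤ Real.exp L := Real.exp_le_exp.mpr h2
        _ = X := Real.exp_log hX0'
    exact_mod_cast h3
  set Φ : ℝ := L ^ κ with hΦ
  have hΦ0 : 0 ≤ Φ := Real.rpow_nonneg hL0.le _
  -- the integral as a finite sum
  rw [integral_window_eq_sum (fun s => ‖moebiusTwistedSum (s.filter (lichtmanTypical X A δ (H X))) α‖)
    X (H X) h1]
  set M : ℕ := ⌊Real.sqrt W⌋₊ with hM
  have hMle : (M : ℝ) ≤ Real.sqrt W := Nat.floor_le (Real.sqrt_nonneg _)
  have hS : ∀ d : ℕ, 1 ≤ d → d ≤ M → ∀ m : ℕ,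
      lichtmanTypical X A δ (H X) (d ^ 2 * m) ↔ lichtmanTypical X A δ (H X) m := by
    intro d hd hdM m
    have hdW : (d : ℝ) ≤ L ^ (A / 2) := by
      rw [← hW12]; exact le_trans (by exact_mod_cast hdM) hMle
    refine lichtmanTypical_sq_mul_iff hd (lt_of_le_of_lt hdW ?_) (lt_of_le_of_lt hdW hP2) m
    exact Real.rpow_lt_rpow_of_exponent_lt hL1 (by linarith)
  -- the per-modulus bound `B(e) = Φ/√(eW)`
  set B : ℕ → ℝ := fun e => Φ / Real.sqrt ((e : ℝ) * W) with hB
  have hP : ∀ e : ℕ, 1 ≤ e → (e : ℝ) ≤ W → ∀ β : ℝ,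
      ∑ k ∈ Icc 1 X, ‖liouvilleTwistedSum ((windowDiv e (H X) k).filter
          (lichtmanTypical X A δ (H X))) β‖ ≤ C₀ * ((H X : ℝ) * X) * B e := by
    intro e he heW β
    have hb := hCX e he heW β
    rw [integral_window_div_eq_sum (fun s => ‖liouvilleTwistedSum (s.filter
        (lichtmanTypical X A δ (H X))) β‖) X (H X) e he] at hb
    refine hb.trans ?_
    calc C * ((H X : ℝ) * X * (Φ / Real.sqrt ((e : ℝ) * W)))
        ≤ C₀ * ((H X : ℝ) * X * (Φ / Real.sqrt ((e : ℝ) * W))) :=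
          mul_le_mul_of_nonneg_right hCC (by positivity)
      _ = C₀ * ((H X : ℝ) * X) * B e := by rw [hB]; ring
  have hmain := keyFourier_fixed_bound_general B (lichtmanTypical X A δ (H X)) α h1 hHleX hW4X hM
    le_rfl hP hS
  -- evaluate `∑_{d ≤ M} B(d²) = Φ/√W ∑ 1/d ≤ Φ (1 + log M)/√W`
  have hM1 : 1 ≤ M := by
    rw [hM]; refine Nat.le_floor ?_
    have : (1 : ℝ) ≤ Real.sqrt W := by rw [Real.le_sqrt' one_pos]; linarith
    exact_mod_cast this
  have hM0 : (0 : ℝ) < M := by exact_mod_cast (by omega : 0 < M)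
  have hsumB : ∑ d ∈ Icc 1 M, B (d ^ 2) ≤ Φ * (1 + A / 2 * Real.log L) / Real.sqrt W := by
    have hterm : ∀ d ∈ Icc 1 M, B (d ^ 2) = Φ / Real.sqrt W * (d : ℝ)⁻¹ := by
      intro d hd
      rw [Finset.mem_Icc] at hd
      have hd0 : (0 : ℝ) < d := by exact_mod_cast hd.1
      rw [hB]
      simp only
      push_cast
      rw [Real.sqrt_mul (sq_nonneg _), Real.sqrt_sq hd0.le]
      field_simp
    rw [Finset.sum_congr rfl hterm, ← Finset.mul_sum]
    have hlogM : Real.log M ≤ A / 2 * Real.log L := by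
      calc Real.log M ≤ Real.log (Real.sqrt W) := Real.log_le_log hM0 hMle
        _ = A / 2 * Real.log L := by rw [hW12, Real.log_rpow hL0]
    calc Φ / Real.sqrt W * ∑ d ∈ Icc 1 M, (d : ℝ)⁻¹ ≤ Φ / Real.sqrt W * (1 + Real.log M) :=
          mul_le_mul_of_nonneg_left (sum_Icc_inv_le_one_add_log M) (by positivity)
      _ ≤ Φ / Real.sqrt W * (1 + A / 2 * Real.log L) :=
          mul_le_mul_of_nonneg_left (by linarith) (by positivity)
      _ = Φ * (1 + A / 2 * Real.log L) / Real.sqrt W := by ring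
  -- the saving
  have hkey : C₀ * ((H X : ℝ) * X) * ∑ d ∈ Icc 1 M, B (d ^ 2) ≤ (H X : ℝ) * X / W ^ (1 / 5 : ℝ) := by
    have hnum : 0 ≤ (H X : ℝ) * X := by positivity
    have hW5 : 0 < W ^ (1 / 5 : ℝ) := Real.rpow_pos_of_pos hW0 _
    have hsW : 0 < Real.sqrt W := Real.sqrt_pos.mpr hW0
    calc C₀ * ((H X : ℝ) * X) * ∑ d ∈ Icc 1 M, B (d ^ 2)
        ≤ C₀ * ((H X : ℝ) * X) * (Φ * (1 + A / 2 * Real.log L) / Real.sqrt W) :=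
          mul_le_mul_of_nonneg_left hsumB (by positivity)
      _ = ((H X : ℝ) * X) * (C₀ * (Φ * (1 + A / 2 * Real.log L)) / Real.sqrt W) := by ring
      _ ≤ ((H X : ℝ) * X) * (1 / W ^ (1 / 5 : ℝ)) := by
          apply mul_le_mul_of_nonneg_left _ hnum
          rw [div_le_div_iff₀ hsW hW5, one_mul, hW12, hW15]
          calc C₀ * (Φ * (1 + A / 2 * Real.log L)) * L ^ (A / 5)
              = C₀ * (L ^ κ * (1 + A / 2 * Real.log L) * L ^ (A / 5)) := by rw [hΦ]; ring
            _ ≤ L ^ (A / 2) := hsav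
      _ = (H X : ℝ) * X / W ^ (1 / 5 : ℝ) := by ring
  rw [hW15] at hmain hkey
  calc _ ≤ C₀ * ((H X : ℝ) * X) * ∑ d ∈ Icc 1 M, B (d ^ 2) + 4 * ((H X : ℝ) * X / L ^ (A / 5)) := hmain
    _ ≤ (H X : ℝ) * X / L ^ (A / 5) + 4 * ((H X : ℝ) * X / L ^ (A / 5)) := by linarith
    _ = (1 + 4) * ((H X : ℝ) * X / L ^ (A / 5)) := by ring

namespace Lichtman2020

/-- **Display (3.1) + Proposition 3.2 ⟹ the weak key Fourier estimate with `κ = 2/3`.**  For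
`α ∈ ℝ` the integrand is `1`-periodic, so `α` may be replaced by its fractional part in
`[0,1] = 𝔐 ∪ 𝔪`; on `𝔐` Proposition 3.2 gives `C HX/(dW) ≤ C HX (log X)^{2/3}/√(dW)`
(`dW ≥ 1`, `log X ≥ 1`); on `𝔪` display (3.1) with `g = λ` gives
`C HX √(log log X/(dW)) ψ(X)` and `√(log log X) ψ(X) ≤ log H ≤ (log X)^{2/3}`
(`H ≤ exp((log X)^{2/3})`, `log log X ≥ 1`). [cite: Lichtman2020, §3, p. 9 and (3.1)] -/
theorem weakLiouvilleBound_of_minorArcBound31 (h31 : Lichtman2020_minorArcBound31)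
    (h32 : Lichtman2020_majorArcEstimate) :
    ∀ A : ℝ, 5 < A → ∀ δ : ℝ, 0 < δ → ∀ H : ℕ → ℕ,
      Tendsto (fun X : ℕ => Real.log (H X) / Real.log (Real.log X)) atTop atTop →
      (∀ᶠ X : ℕ in atTop, (H X : ℝ) ≤ Real.exp (Real.log X ^ (2 / 3 : ℝ))) →
      ∃ C : ℝ, ∀ᶠ X : ℕ in atTop, ∀ d : ℕ, 1 ≤ d → (d : ℝ) ≤ Real.log X ^ A → ∀ α : ℝ,
        ∫ x in (0 : ℝ)..X,
            ‖liouvilleTwistedSum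
                ((Icc ⌈x / d⌉₊ ⌊(x + H X) / d⌋₊).filter (lichtmanTypical X A δ (H X))) α‖
          ≤ C * ((H X : ℝ) * X *
              (Real.log X ^ (2 / 3 : ℝ) / Real.sqrt ((d : ℝ) * Real.log X ^ A))) := by
  intro A hA δ hδ H hH hHexp
  obtain ⟨C₁, hC₁⟩ := h31 A hA δ hδ.le H hH hHexp
  obtain ⟨C₂, hC₂⟩ := h32 A hA δ hδ H hH hHexp
  refine ⟨max (max C₁ C₂) 0, ?_⟩
  have hone := eventually_one_le_H hH
  have hll : ∀ᶠ X : ℕ in atTop, 1 ≤ Real.log (Real.log X) :=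
    (Real.tendsto_log_atTop.comp tendsto_log_natCast).eventually_ge_atTop 1
  filter_upwards [hC₁, hC₂, hHexp, hone, hll, tendsto_log_natCast.eventually_ge_atTop 1]
    with X h1X h2X hHX h1 hllX hL1 d hd hdW α
  set C : ℝ := max (max C₁ C₂) 0 with hC
  have hC0 : 0 ≤ C := le_max_right _ _
  have hCC₁ : C₁ ≤ C := (le_max_left _ _).trans (le_max_left _ _)
  have hCC₂ : C₂ ≤ C := (le_max_right _ _).trans (le_max_left _ _)
  have hL0 : 0 < Real.log X := by linarith
  have hH0 : (0 : ℝ) < H X := by exact_mod_cast h1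
  have hd1 : (1 : ℝ) ≤ d := by exact_mod_cast hd
  have hd0 : (0 : ℝ) < d := by linarith
  have hW1 : 1 ≤ Real.log X ^ A := Real.one_le_rpow hL1 (by linarith)
  have hW0 : 0 < Real.log X ^ A := by linarith
  have hdW1 : 1 ≤ (d : ℝ) * Real.log X ^ A := by nlinarith
  have hsq : 0 < Real.sqrt ((d : ℝ) * Real.log X ^ A) := Real.sqrt_pos.mpr (by positivity)
  have h23 : 1 ≤ Real.log X ^ (2 / 3 : ℝ) := Real.one_le_rpow hL1 (by norm_num)
  have hnum : 0 ≤ (H X : ℝ) * X := by positivity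
  have hT0 : 0 ≤ Real.log X ^ (2 / 3 : ℝ) / Real.sqrt ((d : ℝ) * Real.log X ^ A) := by positivity
  -- reduce to the fractional part
  have hper : ∫ x in (0 : ℝ)..X, ‖liouvilleTwistedSum
      ((Icc ⌈x / d⌉₊ ⌊(x + H X) / d⌋₊).filter (lichtmanTypical X A δ (H X))) α‖ =
      ∫ x in (0 : ℝ)..X, ‖liouvilleTwistedSum
      ((Icc ⌈x / d⌉₊ ⌊(x + H X) / d⌋₊).filter (lichtmanTypical X A δ (H X))) (Int.fract α)‖ := by
    simp_rw [liouvilleTwistedSum_fract]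
  rw [hper]
  have hmem : Int.fract α ∈ Set.Icc (0 : ℝ) 1 := ⟨Int.fract_nonneg α, (Int.fract_lt_one α).le⟩
  rcases mem_majorArcs_or_minorArcs (W := Real.log X ^ A)
      (Q₁ := (H X : ℝ) / Real.log X ^ (4 * A)) hmem with hMaj | hmin
  · -- major arcs
    have hb := h2X d hd hdW (Int.fract α) hMaj
    refine hb.trans ?_
    have hden : 0 < (d : ℝ) * Real.log X ^ A := by positivity
    have hcmp : 1 / ((d : ℝ) * Real.log X ^ A) ≤
        Real.log X ^ (2 / 3 : ℝ) / Real.sqrt ((d : ℝ) * Real.log X ^ A) := by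
      rw [div_le_div_iff₀ hden hsq, one_mul]
      calc Real.sqrt ((d : ℝ) * Real.log X ^ A) ≤ (d : ℝ) * Real.log X ^ A := by
            have := Real.sqrt_le_sqrt
              (show (d : ℝ) * Real.log X ^ A ≤ ((d : ℝ) * Real.log X ^ A) ^ 2 by nlinarith)
            rwa [Real.sqrt_sq hden.le] at this
        _ = 1 * ((d : ℝ) * Real.log X ^ A) := (one_mul _).symm
        _ ≤ Real.log X ^ (2 / 3 : ℝ) * ((d : ℝ) * Real.log X ^ A) :=
            mul_le_mul_of_nonneg_right h23 hden.le
    calc C₂ * ((H X : ℝ) * X / ((d : ℝ) * Real.log X ^ A))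
        ≤ C * ((H X : ℝ) * X / ((d : ℝ) * Real.log X ^ A)) :=
          mul_le_mul_of_nonneg_right hCC₂ (div_nonneg hnum hden.le)
      _ = C * ((H X : ℝ) * X * (1 / ((d : ℝ) * Real.log X ^ A))) := by ring
      _ ≤ C * ((H X : ℝ) * X * (Real.log X ^ (2 / 3 : ℝ) / Real.sqrt ((d : ℝ) * Real.log X ^ A))) :=
          mul_le_mul_of_nonneg_left (mul_le_mul_of_nonneg_left hcmp hnum) hC0
  · -- minor arcs: (3.1) with `g = λ`
    have hg1 : (fun n : ℕ => ((ArithmeticFunction.liouville n : ℤ) : ℂ)) 1 = 1 := by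
      simp [ArithmeticFunction.liouville_apply_one]
    have hgmul : ∀ m n : ℕ, (fun n : ℕ => ((ArithmeticFunction.liouville n : ℤ) : ℂ)) (m * n) =
        (fun n : ℕ => ((ArithmeticFunction.liouville n : ℤ) : ℂ)) m *
          (fun n : ℕ => ((ArithmeticFunction.liouville n : ℤ) : ℂ)) n := by
      intro m n
      simp only [ArithmeticFunction.liouville_apply_mul, Int.cast_mul]
    have hgle : ∀ n : ℕ, ‖(fun n : ℕ => ((ArithmeticFunction.liouville n : ℤ) : ℂ)) n‖ ≤ 1 := by
      intro n
      simp only [Complex.norm_intCast]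
      exact_mod_cast abs_liouville_le_one n
    have hb := h1X d hd hdW _ hg1 hgmul hgle (Int.fract α) hmin
    simp_rw [← liouvilleTwistedSum_eq_twistedSum] at hb
    refine hb.trans ?_
    have hψ0 : 0 ≤ Real.log (H X) / Real.log (Real.log X) :=
      div_nonneg (Real.log_nonneg (by exact_mod_cast h1)) (by linarith)
    have hψle : Real.sqrt (Real.log (Real.log X)) * (Real.log (H X) / Real.log (Real.log X)) ≤
        Real.log X ^ (2 / 3 : ℝ) := by
      have hlogH : Real.log (H X) ≤ Real.log X ^ (2 / 3 : ℝ) := by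
        have := Real.log_le_log hH0 hHX
        rwa [Real.log_exp] at this
      have hs1 : Real.sqrt (Real.log (Real.log X)) ≤ Real.log (Real.log X) := by
        have := Real.sqrt_le_sqrt
          (show Real.log (Real.log X) ≤ Real.log (Real.log X) ^ 2 by nlinarith)
        rwa [Real.sqrt_sq (by linarith)] at this
      calc Real.sqrt (Real.log (Real.log X)) * (Real.log (H X) / Real.log (Real.log X))
          ≤ Real.log (Real.log X) * (Real.log (H X) / Real.log (Real.log X)) :=
            mul_le_mul_of_nonneg_right hs1 hψ0
        _ = Real.log (H X) := by field_simp
        _ ≤ Real.log X ^ (2 / 3 : ℝ) := hlogH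
    have hfac : Real.sqrt (Real.log (Real.log X) / ((d : ℝ) * Real.log X ^ A)) *
        (Real.log (H X) / Real.log (Real.log X)) ≤
        Real.log X ^ (2 / 3 : ℝ) / Real.sqrt ((d : ℝ) * Real.log X ^ A) := by
      rw [Real.sqrt_div (by linarith), div_mul_eq_mul_div]
      exact div_le_div_of_nonneg_right hψle hsq.le
    calc C₁ * ((H X : ℝ) * X * (Real.sqrt (Real.log (Real.log X) / ((d : ℝ) * Real.log X ^ A)) *
          (Real.log (H X) / Real.log (Real.log X))))
        ≤ C * ((H X : ℝ) * X * (Real.sqrt (Real.log (Real.log X) / ((d : ℝ) * Real.log X ^ A)) *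
          (Real.log (H X) / Real.log (Real.log X)))) :=
          mul_le_mul_of_nonneg_right hCC₁ (by positivity)
      _ ≤ C * ((H X : ℝ) * X * (Real.log X ^ (2 / 3 : ℝ) / Real.sqrt ((d : ℝ) * Real.log X ^ A))) :=
          mul_le_mul_of_nonneg_left (mul_le_mul_of_nonneg_left hfac hnum) hC0

end Lichtman2020

open Lichtman2020 in
/-- **Theorem 2.2 from display (3.1) and Proposition 3.2.** [cite: Lichtman2020, Theorem 2.2, (3.1) and Proposition 3.2] -/
theorem Lichtman2020_keyFourierEstimate_of_minorArcBound31 (h31 : Lichtman2020_minorArcBound31)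
    (h32 : Lichtman2020_majorArcEstimate) : Lichtman2020_keyFourierEstimate :=
  Lichtman2020_keyFourierEstimate_of_weakLiouvilleBound (κ := 2 / 3) (by norm_num)
    (weakLiouvilleBound_of_minorArcBound31 h31 h32)

open Lichtman2020 in
/-- **Lichtman's Theorem 1.1 (qualitative part) from (3.1) and Proposition 3.2** — the most robust
form of the decomposition (see `Lichtman2020_minorArcBound31`); the sieve bound (2.5) is the proved
`Lichtman2020_shiftedPrimeSieveBound_holds`. [cite: Lichtman2020, Theorem 1.1] -/
theorem lichtman2020_moebius_shifted_primes_avg_of_minorArcBound31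
    (h31 : Lichtman2020_minorArcBound31) (h32 : Lichtman2020_majorArcEstimate) :
    lichtman2020_moebius_shifted_primes_avg :=
  lichtman2020_moebius_shifted_primes_avg_of_keyFourierEstimate'
    (Lichtman2020_keyFourierEstimate_of_minorArcBound31 h31 h32)

open Lichtman2020 in
/-- **Lichtman's Theorem 1.1 (qualitative part) from Propositions 3.1 and 3.2 as printed**, the
hypothesis `(2.5)` of `lichtman2020_moebius_shifted_primes_avg_of_arcs` being discharged by
`Lichtman2020_shiftedPrimeSieveBound_holds`. [cite: Lichtman2020, Theorem 1.1] -/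
theorem lichtman2020_moebius_shifted_primes_avg_of_arcs' (h31 : Lichtman2020_minorArcEstimate)
    (h32 : Lichtman2020_majorArcEstimate) : lichtman2020_moebius_shifted_primes_avg :=
  lichtman2020_moebius_shifted_primes_avg_of_arcs h31 h32 Lichtman2020_shiftedPrimeSieveBound_holds

end Literature.NumberTheory.Sieve
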